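import Literature.Analysis.FunctionSpaces.TorusInverseLaplacianCalculus
import HarnessLib

/-!
# The inverse Laplacian on `T^d` as a Fourier multiplier; Parseval `L²` bounds for `Δ⁻¹`, `∂Δ⁻¹`, `∂∂Δ⁻¹`

Analysis/FunctionSpaces support file. The accepted operator `Torus.invLaplacian`
(`TorusInverseLaplacian`; Cheskidov–Luo 2022, §7.2 = App. B: "`Δ⁻¹f` … on Fourier coefficients
`Δ` is multiplication by `-4π²|k|²`") satisfies `Δ(Δ⁻¹h) = h - ∫h` and `∫Δ⁻¹h = 0`; reading these
on Fourier coefficients gives the multiplier description and, by Parseval, the quantitative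
`L²` bounds that a Calderón–Zygmund-free treatment of the antidivergence needs (CL22 Thm. 7.3
proves `L^p` bounds for all `p` by singular integrals; on `L²` Plancherel suffices):

* `Torus.invLaplacianMultiplier k = (-4π²|k|²)⁻¹` (`k ≠ 0`), `0` at `k = 0`, with the symbol bounds
  `‖m(k)‖ ≤ (4π²)⁻¹`, `(2π|kⱼ|)‖m(k)‖ ≤ (2π)⁻¹`, `(2π|kᵢ|)(2π|kⱼ|)‖m(k)‖ ≤ 1` (`|kⱼ| ≤ |k|²`);
* `Torus.mFourierCoeff_ofReal_invLaplacian`: `𝓕(Δ⁻¹h)(k) = m(k) 𝓕h(k)` for smooth real `h`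
  (complexified by `ofReal`);
* `Torus.integral_sq_invLaplacian_le`: `∫ (Δ⁻¹h)² ≤ (4π²)⁻² ∫ h²`;
  `Torus.integral_sq_partialDeriv_invLaplacian_le`: `∫ (∂ⱼΔ⁻¹h)² ≤ (2π)⁻² ∫ h²`;
  `Torus.integral_sq_partialDeriv_partialDeriv_invLaplacian_le`: `∫ (∂ᵢ∂ⱼΔ⁻¹h)² ≤ ∫ h²`
  (Parseval `Torus.hasSum_sq_mFourierCoeff_of_continuous`, `𝓕(∂ⱼg) = 2πikⱼ𝓕g`).

Consumers: the `L²`-boundedness of the De Lellis–Székelyhidi antidivergence `ℛ`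
(`FluidPDE/Antidivergence`, built from `Δ⁻¹`, `Δ⁻²`, `∂ᵢ`) in the assembly of CL22 Prop. 4.1
(`Torus.CheskidovLuo2022ConvexIntegration`). Everything is proved.

## References

* A. Cheskidov, X. Luo, *Sharp nonuniqueness for the Navier–Stokes equations*, Invent. Math. 229
  (2022) = arXiv:2009.06596, §7.2 (`Δ⁻¹`), Thm. 7.3 (the `L^p` bounds replaced here by `L²`).
  [`CheskidovLuo2022`]
* L. Grafakos, *Classical Fourier Analysis*, 3rd ed. (2014), Prop. 3.2.7 (Parseval on `T^n`).
  [`Grafakos2014`]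
-/

noncomputable section

open MeasureTheory Set Filter Topology Function UnitAddTorus Complex
open scoped ComplexConjugate ENNReal ContDiff

namespace Literature.Analysis.FunctionSpaces

namespace Torus

variable {d : Type*} [Fintype d] [DecidableEq d]

/-! ## Fourier coefficients of `Δ⁻¹w` -/

omit [DecidableEq d] in
/-- The zeroth Fourier coefficient is the mean. [folklore] -/
theorem mFourierCoeff_zero_eq_integral (g : UnitAddTorus d → ℂ) : mFourierCoeff g 0 = ∫ x, g x := by
  rw [mFourierCoeff_eq_integral_conj_mul]
  refine integral_congr_ae (Eventually.of_forall fun x => ?_)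
  simp [mFourier_zero]

omit [DecidableEq d] in
/-- `4π²|k|² > 0` off the zero mode. [folklore] -/
theorem fourPiSq_mul_freqNormSq_pos {k : d → ℤ} (hk : k ≠ 0) : 0 < 4 * Real.pi ^ 2 * freqNormSq k := by
  have := one_le_freqNormSq_of_ne_zero hk
  have hπ := Real.pi_pos
  positivity

/-- The symbol of `Δ⁻¹`: `m(k) = (-4π²|k|²)⁻¹` for `k ≠ 0`, `m(0) = 0`. [folklore] -/
def invLaplacianMultiplier (k : d → ℤ) : ℂ :=
  if k = 0 then 0 else (((-(4 * Real.pi ^ 2 * freqNormSq k)) : ℝ) : ℂ)⁻¹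

omit [DecidableEq d] in
/-- `‖m(k)‖ = (4π²|k|²)⁻¹` for `k ≠ 0`. [folklore] -/
theorem norm_invLaplacianMultiplier_of_ne_zero {k : d → ℤ} (hk : k ≠ 0) :
    ‖invLaplacianMultiplier k‖ = (4 * Real.pi ^ 2 * freqNormSq k)⁻¹ := by
  rw [invLaplacianMultiplier, if_neg hk, norm_inv, Complex.norm_real, Real.norm_eq_abs, abs_neg,
    abs_of_pos (fourPiSq_mul_freqNormSq_pos hk)]

omit [DecidableEq d] in
/-- `|kⱼ| ≤ |k|²` for lattice points. [folklore] -/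
theorem abs_apply_le_freqNormSq (k : d → ℤ) (j : d) : |(k j : ℝ)| ≤ freqNormSq k := by
  have hsq : ((k j : ℝ)) ^ 2 ≤ freqNormSq k :=
    Finset.single_le_sum (f := fun i => ((k i : ℝ)) ^ 2) (fun i _ => sq_nonneg _) (Finset.mem_univ j)
  have hint : |(k j : ℝ)| ≤ ((k j : ℝ)) ^ 2 := by
    rw [← sq_abs]
    rcases eq_or_ne (k j) 0 with h | h
    · simp [h]
    · have : (1 : ℝ) ≤ |(k j : ℝ)| := by exact_mod_cast Int.one_le_abs h
      nlinarith
  exact hint.trans hsq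

omit [DecidableEq d] in
/-- `|kᵢ| |kⱼ| ≤ |k|²` for lattice points. [folklore] -/
theorem abs_mul_abs_le_freqNormSq (k : d → ℤ) (i j : d) : |(k i : ℝ)| * |(k j : ℝ)| ≤ freqNormSq k := by
  have hki : ((k i : ℝ)) ^ 2 ≤ freqNormSq k :=
    Finset.single_le_sum (f := fun l => ((k l : ℝ)) ^ 2) (fun l _ => sq_nonneg _) (Finset.mem_univ i)
  have hkj : ((k j : ℝ)) ^ 2 ≤ freqNormSq k :=
    Finset.single_le_sum (f := fun l => ((k l : ℝ)) ^ 2) (fun l _ => sq_nonneg _) (Finset.mem_univ j)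
  nlinarith [sq_abs (k i : ℝ), sq_abs (k j : ℝ), abs_nonneg (k i : ℝ), abs_nonneg (k j : ℝ),
    sq_nonneg (|(k i : ℝ)| - |(k j : ℝ)|)]

omit [DecidableEq d] in
/-- `‖m(k)‖ ≤ (4π²)⁻¹`. [folklore] -/
theorem norm_invLaplacianMultiplier_le (k : d → ℤ) : ‖invLaplacianMultiplier k‖ ≤ (4 * Real.pi ^ 2)⁻¹ := by
  by_cases hk : k = 0
  · rw [invLaplacianMultiplier, if_pos hk, norm_zero]; positivity
  · rw [norm_invLaplacianMultiplier_of_ne_zero hk]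
    have h1 := one_le_freqNormSq_of_ne_zero hk
    exact inv_anti₀ (by positivity) (by nlinarith [Real.pi_pos, sq_nonneg Real.pi])

omit [DecidableEq d] in
/-- One derivative of `Δ⁻¹`: `(2π|kⱼ|) ‖m(k)‖ ≤ (2π)⁻¹` (`|kⱼ| ≤ |k|²`). [folklore] -/
theorem mul_norm_invLaplacianMultiplier_le (k : d → ℤ) (j : d) :
    2 * Real.pi * |(k j : ℝ)| * ‖invLaplacianMultiplier k‖ ≤ (2 * Real.pi)⁻¹ := by
  have hπ := Real.pi_pos
  by_cases hk : k = 0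
  · subst hk
    rw [invLaplacianMultiplier, if_pos rfl, norm_zero, mul_zero]
    positivity
  · rw [norm_invLaplacianMultiplier_of_ne_zero hk, mul_inv_le_iff₀ (fourPiSq_mul_freqNormSq_pos hk)]
    have h := abs_apply_le_freqNormSq k j
    rw [show (2 * Real.pi)⁻¹ * (4 * Real.pi ^ 2 * freqNormSq k) = 2 * Real.pi * freqNormSq k by field_simp; ring]
    exact mul_le_mul_of_nonneg_left h (by positivity)

omit [DecidableEq d] in
/-- Two derivatives of `Δ⁻¹`: `(2π|kᵢ|)(2π|kⱼ|) ‖m(k)‖ ≤ 1` (`|kᵢ||kⱼ| ≤ |k|²`). [folklore] -/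
theorem mul_mul_norm_invLaplacianMultiplier_le (k : d → ℤ) (i j : d) :
    (2 * Real.pi * |(k i : ℝ)|) * (2 * Real.pi * |(k j : ℝ)|) * ‖invLaplacianMultiplier k‖ ≤ 1 := by
  have hπ := Real.pi_pos
  by_cases hk : k = 0
  · subst hk
    rw [invLaplacianMultiplier, if_pos rfl, norm_zero, mul_zero]
    exact zero_le_one
  · rw [norm_invLaplacianMultiplier_of_ne_zero hk, mul_inv_le_iff₀ (fourPiSq_mul_freqNormSq_pos hk), one_mul]
    have h := abs_mul_abs_le_freqNormSq k i j
    nlinarith [sq_nonneg Real.pi]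

/-- **Fourier coefficients of the inverse Laplacian** of a smooth real function:
`𝓕(Δ⁻¹h)(k) = m(k) 𝓕h(k)`, `m(k) = (-4π²|k|²)⁻¹` off the zero mode and `𝓕(Δ⁻¹h)(0) = 0` (read off
the proved identities `Δ(Δ⁻¹h) = h - ∫h`, `∫ Δ⁻¹h = 0`; functions complexified by `ofReal`). [cite: CheskidovLuo2022, §7.2] -/
theorem mFourierCoeff_ofReal_invLaplacian [Nonempty d] {h : UnitAddTorus d → ℝ} (hh : IsSmooth h) (k : d → ℤ) :
    mFourierCoeff (fun x => ((invLaplacian h x : ℝ) : ℂ)) k =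
      invLaplacianMultiplier k * mFourierCoeff (fun x => (h x : ℂ)) k := by
  set w : UnitAddTorus d → ℂ := fun x => (h x : ℂ) with hw_def
  have hw : IsSmooth w := hh.ofReal
  have hcomp : (fun x => ((invLaplacian h x : ℝ) : ℂ)) = invLaplacian w := by
    have := invLaplacian_clm_comp hh Complex.ofRealCLM
    funext x
    exact (congr_fun this x).symm
  rw [hcomp]
  have hv : IsSmooth (invLaplacian w) := isSmooth_invLaplacian hw
  have hint : ∫ y, w y = ((∫ y, h y : ℝ) : ℂ) := integral_ofReal
  by_cases hk : k = 0
  · subst hk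
    rw [invLaplacianMultiplier, if_pos rfl, zero_mul, mFourierCoeff_zero_eq_integral, integral_invLaplacian hw]
  · rw [invLaplacianMultiplier, if_neg hk]
    have h1 := mFourierCoeff_laplacian_complex hv k
    have h2 : laplacian (invLaplacian w) = w - fun _ => ((∫ y, h y : ℝ) : ℂ) :=
      funext fun x => by rw [Pi.sub_apply, ← hint]; exact laplacian_invLaplacian_of_completeSpace hw x
    rw [h2, mFourierCoeff_sub hw.integrable (integrable_const _), mFourierCoeff_const_real] at h1
    simp only [hk, if_false, sub_zero] at h1
    have hne : ((4 * Real.pi ^ 2 * freqNormSq k : ℝ) : ℂ) ≠ 0 := by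
      exact_mod_cast (fourPiSq_mul_freqNormSq_pos hk).ne'
    rw [h1, ← mul_assoc, Complex.ofReal_neg, inv_neg, neg_mul_neg, inv_mul_cancel₀ hne, one_mul]

/-! ## Parseval bounds for `Δ⁻¹h`, `∂ⱼΔ⁻¹h`, `∂ᵢ∂ⱼΔ⁻¹h` -/

omit [DecidableEq d] in
/-- Parseval for a real continuous function, through its complexification. [folklore] -/
theorem hasSum_sq_mFourierCoeff_ofReal {g : UnitAddTorus d → ℝ} (hg : Continuous g) :
    HasSum (fun k => ‖mFourierCoeff (fun x => (g x : ℂ)) k‖ ^ 2) (∫ x, g x ^ 2) := by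
  have h := hasSum_sq_mFourierCoeff_of_continuous (g := fun x => ((g x : ℝ) : ℂ)) (Complex.continuous_ofReal.comp hg)
  have h2 : (∫ x, ‖((g x : ℝ) : ℂ)‖ ^ 2) = ∫ x, g x ^ 2 :=
    integral_congr_ae (Eventually.of_forall fun x => by simp [Complex.norm_real, sq_abs])
  rwa [h2] at h

/-- **`L²` bound for the inverse Laplacian**: `∫ (Δ⁻¹h)² ≤ (4π²)⁻² ∫ h²` for smooth real `h`
(Parseval: `|m(k)| ≤ (4π²)⁻¹`). [folklore] -/
theorem integral_sq_invLaplacian_le [Nonempty d] {h : UnitAddTorus d → ℝ} (hh : IsSmooth h) :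
    ∫ x, invLaplacian h x ^ 2 ≤ ((4 * Real.pi ^ 2)⁻¹) ^ 2 * ∫ x, h x ^ 2 := by
  have hv : IsSmooth (invLaplacian h) := isSmooth_invLaplacian hh
  have hP1 := hasSum_sq_mFourierCoeff_ofReal hv.continuous
  have hP2 := (hasSum_sq_mFourierCoeff_ofReal hh.continuous).mul_left (((4 * Real.pi ^ 2)⁻¹) ^ 2)
  refine hasSum_le (fun k => ?_) hP1 hP2
  rw [mFourierCoeff_ofReal_invLaplacian hh, norm_mul, mul_pow]
  exact mul_le_mul_of_nonneg_right (pow_le_pow_left₀ (norm_nonneg _) (norm_invLaplacianMultiplier_le k) 2)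
    (sq_nonneg _)

omit [Fintype d] [DecidableEq d] in
/-- `‖2πi n‖ = 2π|n|`. [folklore] -/
theorem norm_two_pi_I_mul_intCast (n : ℤ) : ‖(2 * Real.pi * Complex.I * (n : ℂ))‖ = 2 * Real.pi * |(n : ℝ)| := by
  rw [norm_mul, norm_mul, norm_mul, Complex.norm_I, mul_one, Complex.norm_intCast, Complex.norm_ofNat, Complex.norm_real,
    Real.norm_eq_abs, abs_of_pos Real.pi_pos]

/-- **`L²` bound for one derivative of the inverse Laplacian**: `∫ (∂ⱼΔ⁻¹h)² ≤ (2π)⁻² ∫ h²`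
(`𝓕(∂ⱼg) = 2πikⱼ 𝓕g` and `(2π|kⱼ|)|m(k)| ≤ (2π)⁻¹`). [folklore] -/
theorem integral_sq_partialDeriv_invLaplacian_le [Nonempty d] {h : UnitAddTorus d → ℝ} (hh : IsSmooth h) (j : d) :
    ∫ x, partialDeriv j (invLaplacian h) x ^ 2 ≤ ((2 * Real.pi)⁻¹) ^ 2 * ∫ x, h x ^ 2 := by
  have hv : IsSmooth (invLaplacian h) := isSmooth_invLaplacian hh
  have hvj : IsSmooth (partialDeriv j (invLaplacian h)) := hv.partialDeriv j
  have hP1 := hasSum_sq_mFourierCoeff_ofReal hvj.continuous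
  have hP2 := (hasSum_sq_mFourierCoeff_ofReal hh.continuous).mul_left (((2 * Real.pi)⁻¹) ^ 2)
  refine hasSum_le (fun k => ?_) hP1 hP2
  -- coefficients of the derivative of the complexification
  have hc : (fun x => ((partialDeriv j (invLaplacian h) x : ℝ) : ℂ)) =
      partialDeriv j (fun x => ((invLaplacian h x : ℝ) : ℂ)) := by
    funext x
    exact (partialDeriv_clm_comp hv Complex.ofRealCLM j x).symm
  rw [hc, mFourierCoeff_partialDeriv hv.ofReal, mFourierCoeff_ofReal_invLaplacian hh, smul_eq_mul, ← mul_assoc,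
    norm_mul (2 * Real.pi * Complex.I * (k j : ℂ) * invLaplacianMultiplier k),
    norm_mul (2 * Real.pi * Complex.I * (k j : ℂ)), norm_two_pi_I_mul_intCast, mul_pow]
  exact mul_le_mul_of_nonneg_right
    (pow_le_pow_left₀ (by positivity) (mul_norm_invLaplacianMultiplier_le k j) 2) (sq_nonneg _)

/-- **`L²` bound for two derivatives of the inverse Laplacian**: `∫ (∂ᵢ∂ⱼΔ⁻¹h)² ≤ ∫ h²`. [folklore] -/
theorem integral_sq_partialDeriv_partialDeriv_invLaplacian_le [Nonempty d] {h : UnitAddTorus d → ℝ}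
    (hh : IsSmooth h) (i j : d) :
    ∫ x, partialDeriv i (partialDeriv j (invLaplacian h)) x ^ 2 ≤ ∫ x, h x ^ 2 := by
  have hv : IsSmooth (invLaplacian h) := isSmooth_invLaplacian hh
  have hvj : IsSmooth (partialDeriv j (invLaplacian h)) := hv.partialDeriv j
  have hvij : IsSmooth (partialDeriv i (partialDeriv j (invLaplacian h))) := hvj.partialDeriv i
  have hP1 := hasSum_sq_mFourierCoeff_ofReal hvij.continuous
  have hP2 := hasSum_sq_mFourierCoeff_ofReal hh.continuous
  refine hasSum_le (fun k => ?_) hP1 hP2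
  have hc1 : (fun x => ((partialDeriv i (partialDeriv j (invLaplacian h)) x : ℝ) : ℂ)) =
      partialDeriv i (fun x => ((partialDeriv j (invLaplacian h) x : ℝ) : ℂ)) := by
    funext x; exact (partialDeriv_clm_comp hvj Complex.ofRealCLM i x).symm
  have hc2 : (fun x => ((partialDeriv j (invLaplacian h) x : ℝ) : ℂ)) =
      partialDeriv j (fun x => ((invLaplacian h x : ℝ) : ℂ)) := by
    funext x; exact (partialDeriv_clm_comp hv Complex.ofRealCLM j x).symm
  rw [hc1, mFourierCoeff_partialDeriv hvj.ofReal, hc2, mFourierCoeff_partialDeriv hv.ofReal,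
    mFourierCoeff_ofReal_invLaplacian hh, smul_eq_mul, smul_eq_mul]
  have hassoc : 2 * Real.pi * Complex.I * (k i : ℂ) * (2 * Real.pi * Complex.I * (k j : ℂ) *
      (invLaplacianMultiplier k * mFourierCoeff (fun x => (h x : ℂ)) k)) =
      (2 * Real.pi * Complex.I * (k i : ℂ) * (2 * Real.pi * Complex.I * (k j : ℂ)) * invLaplacianMultiplier k) *
        mFourierCoeff (fun x => (h x : ℂ)) k := by ring
  rw [hassoc, norm_mul, norm_mul (2 * Real.pi * Complex.I * (k i : ℂ) * (2 * Real.pi * Complex.I * (k j : ℂ))),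
    norm_mul (2 * Real.pi * Complex.I * (k i : ℂ)), norm_two_pi_I_mul_intCast, norm_two_pi_I_mul_intCast, mul_pow]
  have hb := mul_mul_norm_invLaplacianMultiplier_le k i j
  have h0 : 0 ≤ 2 * Real.pi * |(k i : ℝ)| * (2 * Real.pi * |(k j : ℝ)|) * ‖invLaplacianMultiplier k‖ := by positivity
  calc (2 * Real.pi * |(k i : ℝ)| * (2 * Real.pi * |(k j : ℝ)|) * ‖invLaplacianMultiplier k‖) ^ 2 *
        ‖mFourierCoeff (fun x => (h x : ℂ)) k‖ ^ 2
      ≤ 1 ^ 2 * ‖mFourierCoeff (fun x => (h x : ℂ)) k‖ ^ 2 := by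
        gcongr
    _ = ‖mFourierCoeff (fun x => (h x : ℂ)) k‖ ^ 2 := by rw [one_pow, one_mul]

end Torus
end Literature.Analysis.FunctionSpaces
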